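import Mathlib
import Summits.Ventures.PercRepro.TriangleCapGraphArith
import Summits.Ventures.PercRepro.TriangleCapGraphConn

/-!
# PercRepro — the GRAPHIC closed form: `T(G) ≤ P_KK(e + 1 − n)` for every finite connected simple graph (p3, gen 24)

`P = P_KK` is the prefix sum of the increment sequence `(1)(1,2)(1,2,3)…` of `TriangleCapClosedFormArith`
(`P (tri t + i) = C(t+2,3) + C(i+1,2)`, the triangle count of `K_{t+2}` plus a vertex of degree `i + 1`).
THEOREM (`card_triangles_le_P`): for a finite connected simple graph `G` on `n` vertices with `e` edges,
`#(G.cliqueFinset 3) ≤ P (e + 1 − n)` — the cyclomatic number `ν = e + 1 − n` bounds the number of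
triangles by `P_KK(ν)`, with equality on `K_k` plus a vertex joined to `j` of its vertices (P3-TRIANGLE-CAP.md
§10b / §10f / §10l).

PROOF (`main_aux`; vertex deletion on vertex finsets carrying the cut criterion `IsConn`, no components):
a connected `S` with `≥ 2` vertices has a non-cut vertex `v` (`exists_noncut`); with `d = #N` its degree in `S`
(`N = nbrs G S v`), `e(S) = e(S') + d` and `T(S) = T(S') + e(N)` (`card_cliques_succ`); THE GAIN BOUND
`e(N) ≤ min (C(d,2)) ν`, `ν = e(S) + 1 − #S`: `e(N) ≤ C(d,2)` trivially and `e(N) ≤ ν` because the edges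
of `S'` touching `W = S' ∖ N` number at least `#W` (`card_le_card_touching`), so `e(S') ≥ e(N) + #S' − d`;
the induction closes by the arithmetic `min (C(d,2)) ν + P (ν − (d − 1)) ≤ P ν` (`KK.L2'`).
Mathlib enters only at the end: `G.Connected` gives the cut criterion on `univ` (`isConn_univ_of_connected`),
`cliques univ 3 = G.cliqueFinset 3`, and `#G.edgeFinset = #(cliques univ 2)` via `Sym2.toFinset`.
SHARPNESS (`decide`): equality at `K₄`, `K₅`, `K₅ + a vertex of degree 2`, `K₅ + a vertex of degree 3`
(`ν = 3, 6, 7, 8`; `P = 4, 10, 11, 13`). Axioms: standard.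
-/

namespace PercRepro

namespace TriangleCap

namespace Graph

open Finset

section Main

variable {V : Type*} [DecidableEq V] (G : SimpleGraph V) [DecidableRel G.Adj]

/-- **The induction:** for a nonempty connected vertex set `S`, `#S ≤ e(S) + 1` and
`T(S) ≤ P (e(S) + 1 − #S)`, where `e(S) = #(cliques S 2)` and `T(S) = #(cliques S 3)`. -/
theorem main_aux (n : ℕ) : ∀ S : Finset V, S.card = n → IsConn G S → S.Nonempty →
    S.card ≤ (cliques G S 2).card + 1 ∧
      (cliques G S 3).card ≤ KK.P ((cliques G S 2).card + 1 - S.card) := by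
  induction n using Nat.strong_induction_on with
  | _ n ih =>
  intro S hn hS hne
  rcases Nat.lt_or_ge n 2 with hlt | hge
  · have h1 : S.card = 1 := by have := hne.card_pos; omega
    obtain ⟨v, rfl⟩ := card_eq_one.1 h1
    have h2 : (cliques G {v} 2).card = 0 := by
      apply Nat.eq_zero_of_le_zero
      calc (cliques G {v} 2).card ≤ (({v} : Finset V).card).choose 2 := card_cliques_le_choose G _ _
        _ = 0 := by rw [card_singleton]; decide
    have h3 : (cliques G {v} 3).card = 0 := by
      apply Nat.eq_zero_of_le_zero
      calc (cliques G {v} 3).card ≤ (({v} : Finset V).card).choose 3 := card_cliques_le_choose G _ _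
        _ = 0 := by rw [card_singleton]; decide
    rw [h2, h3, card_singleton]
    simp [KK.P_zero]
  · obtain ⟨v, hv, hconn'⟩ := exists_noncut G hS (by omega)
    have hcard' : (S.erase v).card = n - 1 := by rw [card_erase_of_mem hv, hn]
    have hne' : (S.erase v).Nonempty := by rw [← card_pos, hcard']; omega
    obtain ⟨ih1, ih2⟩ := ih (n - 1) (by omega) (S.erase v) hcard' hconn' hne'
    have hd1 : 1 ≤ (nbrs G S v).card := by
      have hne1 : ({v} : Finset V) ≠ S := by
        intro h
        have := congrArg Finset.card h
        rw [card_singleton] at this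
        omega
      obtain ⟨a, ha, b, hbS, hbA, hab⟩ :=
        hS {v} (singleton_subset_iff.2 hv) (singleton_nonempty v) hne1
      rw [mem_singleton] at ha hbA
      subst ha
      have : b ∈ nbrs G S a := by rw [mem_nbrs]; exact ⟨hbS, hbA, hab⟩
      exact card_pos.2 ⟨b, this⟩
    have he : (cliques G S 2).card = (cliques G (S.erase v) 2).card + (nbrs G S v).card := by
      rw [card_cliques_succ G hv 1, card_cliques_one]
    have hT : (cliques G S 3).card =
        (cliques G (S.erase v) 3).card + (cliques G (nbrs G S v) 2).card :=
      card_cliques_succ G hv 2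
    have hg1 : (cliques G (nbrs G S v) 2).card ≤ (nbrs G S v).card.choose 2 :=
      card_cliques_le_choose G _ _
    have hNS' : nbrs G S v ⊆ S.erase v := nbrs_subset_erase G S v
    have hsd : S.erase v \ (S.erase v \ nbrs G S v) = nbrs G S v := Finset.sdiff_sdiff_eq_self hNS'
    have hpart : (cliques G (S.erase v) 2).card =
        (cliques G (nbrs G S v) 2).card + (touching G (S.erase v) (S.erase v \ nbrs G S v)).card := by
      rw [card_cliques_two_eq G (S.erase v) (S.erase v \ nbrs G S v), hsd]
    have hWcard : (S.erase v \ nbrs G S v).card = (S.erase v).card - (nbrs G S v).card :=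
      card_sdiff_of_subset hNS'
    have hWS' : S.erase v \ nbrs G S v ≠ S.erase v := by
      intro h
      obtain ⟨b, hb⟩ := card_pos.1 hd1
      have : b ∈ S.erase v \ nbrs G S v := by rw [h]; exact hNS' hb
      rw [mem_sdiff] at this
      exact this.2 hb
    have htouch := card_le_card_touching G hconn' (S.erase v \ nbrs G S v) sdiff_subset hWS'
    have hdS' : (nbrs G S v).card ≤ (S.erase v).card := card_le_card hNS'
    have hScard : S.card = (S.erase v).card + 1 := by rw [hcard', hn]; omega
    refine ⟨by omega, ?_⟩
    have hν' : (cliques G (S.erase v) 2).card + 1 - (S.erase v).card =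
        ((cliques G S 2).card + 1 - S.card) - ((nbrs G S v).card - 1) := by omega
    have key := KK.L2' (nbrs G S v).card ((cliques G S 2).card + 1 - S.card) hd1 (by omega)
    rw [hν'] at ih2
    have hmin : (cliques G (nbrs G S v) 2).card ≤
        min ((nbrs G S v).card.choose 2) ((cliques G S 2).card + 1 - S.card) :=
      le_min hg1 (by omega)
    rw [hT]
    omega

/-- `cliques univ k` is Mathlib's `cliqueFinset k`. -/
theorem cliques_univ_eq_cliqueFinset [Fintype V] (k : ℕ) : cliques G univ k = G.cliqueFinset k := by
  ext t
  rw [mem_cliques, SimpleGraph.mem_cliqueFinset_iff, SimpleGraph.isNClique_iff]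
  simp only [subset_univ, true_and]
  exact and_comm

/-- The edge count is the number of `2`-cliques. -/
theorem card_edgeFinset_eq_card_cliques_two [Fintype V] [Fintype G.edgeSet] :
    G.edgeFinset.card = (cliques G univ 2).card := by
  refine card_bij (fun e _ => e.toFinset) ?_ ?_ ?_
  · intro e he
    rw [SimpleGraph.mem_edgeFinset] at he
    rw [mem_cliques]
    refine ⟨subset_univ _, Sym2.card_toFinset_of_not_isDiag e (G.not_isDiag_of_mem_edgeSet he), ?_⟩
    induction e using Sym2.ind with
    | h x y =>
      rw [Sym2.toFinset_mk_eq, coe_pair]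
      rw [SimpleGraph.mem_edgeSet] at he
      exact SimpleGraph.isClique_pair.2 (fun _ => he)
  · intro e₁ he₁ e₂ he₂ h
    induction e₁ using Sym2.ind with
    | h a b =>
    induction e₂ using Sym2.ind with
    | h c d =>
    rw [Sym2.toFinset_mk_eq, Sym2.toFinset_mk_eq] at h
    rw [SimpleGraph.mem_edgeFinset, SimpleGraph.mem_edgeSet] at he₁
    have hab : a ≠ b := G.ne_of_adj he₁
    have ha : a ∈ ({c, d} : Finset V) := h ▸ mem_insert_self a {b}
    have hb : b ∈ ({c, d} : Finset V) := h ▸ mem_insert_of_mem (mem_singleton_self b)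
    simp only [mem_insert, mem_singleton] at ha hb
    rcases ha with rfl | rfl <;> rcases hb with rfl | rfl
    · exact absurd rfl hab
    · rfl
    · exact Sym2.eq_swap
    · exact absurd rfl hab
  · intro t ht
    rw [mem_cliques] at ht
    obtain ⟨-, hcard, hcl⟩ := ht
    obtain ⟨a, b, hab, rfl⟩ := card_eq_two.1 hcard
    refine ⟨s(a, b), ?_, Sym2.toFinset_mk_eq⟩
    rw [SimpleGraph.mem_edgeFinset, SimpleGraph.mem_edgeSet]
    rw [coe_pair] at hcl
    exact SimpleGraph.isClique_pair.1 hcl hab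

/-- **THE GRAPHIC CLOSED FORM.** For every finite connected simple graph `G` with `n` vertices and `e`
edges, the number of triangles is at most `P_KK(e + 1 − n)` — `P_KK(ν) = C(k,3) + C(j,2)` for the
cyclomatic number `ν = e + 1 − n = C(k−1,2) + j − 1`, `1 ≤ j ≤ k` (`KK.P_closed`); equality for `K_k`
plus a vertex joined to `j` of its vertices. -/
theorem card_triangles_le_P [Fintype V] [Fintype G.edgeSet] (h : G.Connected) :
    (G.cliqueFinset 3).card ≤ KK.P (G.edgeFinset.card + 1 - Fintype.card V) := by
  haveI := h.nonempty
  obtain ⟨-, h2⟩ := main_aux G _ univ rfl (isConn_univ_of_connected G h) univ_nonempty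
  rw [card_edgeFinset_eq_card_cliques_two, ← card_univ, ← cliques_univ_eq_cliqueFinset]
  exact h2

/-- The same bound with the cyclomatic number as an explicit hypothesis: if `e + 1 = n + ν` then
`#(G.cliqueFinset 3) ≤ P ν`. -/
theorem card_triangles_le_P_of_cyclomatic [Fintype V] [Fintype G.edgeSet] (h : G.Connected) {ν : ℕ}
    (hν : G.edgeFinset.card + 1 = Fintype.card V + ν) : (G.cliqueFinset 3).card ≤ KK.P ν := by
  have := card_triangles_le_P G h
  rwa [hν, Nat.add_sub_cancel_left] at this

end Main

section Sharpness

/-! ### Sharpness: the bound is attained at `ν = 3, 6, 7, 8` (`K₄`, `K₅`, `K₅ + a vertex of degree 2 / 3`). -/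

/-- `K₅` (vertices `0 … 4`) plus the vertex `5` joined to `0` and `1`: the extremal graph at `ν = 7`. -/
abbrev K5plus2 : SimpleGraph (Fin 6) :=
  SimpleGraph.fromRel (fun a b => a.val < 5 ∧ b.val < 5 ∨ a.val < 2 ∨ b.val < 2)

/-- `K₅` plus the vertex `5` joined to `0`, `1`, `2`: the extremal graph at `ν = 8`. -/
abbrev K5plus3 : SimpleGraph (Fin 6) :=
  SimpleGraph.fromRel (fun a b => a.val < 5 ∧ b.val < 5 ∨ a.val < 3 ∨ b.val < 3)

/-- `K₄`: `4` triangles, `6` edges, `ν = 3`, `P 3 = 4` — equality in `card_triangles_le_P`. -/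
theorem K4_sharp : ((⊤ : SimpleGraph (Fin 4)).cliqueFinset 3).card =
    KK.P ((⊤ : SimpleGraph (Fin 4)).edgeFinset.card + 1 - Fintype.card (Fin 4)) := by decide

/-- `K₅`: `10` triangles, `10` edges, `ν = 6`, `P 6 = 10` — equality in `card_triangles_le_P`. -/
theorem K5_sharp : ((⊤ : SimpleGraph (Fin 5)).cliqueFinset 3).card =
    KK.P ((⊤ : SimpleGraph (Fin 5)).edgeFinset.card + 1 - Fintype.card (Fin 5)) := by decide

/-- `K₅` plus a vertex of degree `2`: `11` triangles, `12` edges, `ν = 7`, `P 7 = 11` — equality. -/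
theorem K5plus2_sharp : (K5plus2.cliqueFinset 3).card =
    KK.P (K5plus2.edgeFinset.card + 1 - Fintype.card (Fin 6)) := by decide

/-- `K₅` plus a vertex of degree `3`: `13` triangles, `13` edges, `ν = 8`, `P 8 = 13` — equality. -/
theorem K5plus3_sharp : (K5plus3.cliqueFinset 3).card =
    KK.P (K5plus3.edgeFinset.card + 1 - Fintype.card (Fin 6)) := by decide

/-- The witness at `ν = 7` is connected (so `card_triangles_le_P` applies to it). -/
theorem K5plus2_connected : K5plus2.Connected := by
  rw [SimpleGraph.connected_iff_exists_forall_reachable]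
  refine ⟨0, fun w => ?_⟩
  fin_cases w <;> first | rfl | exact SimpleGraph.Adj.reachable (by decide)

/-- The witness at `ν = 8` is connected. -/
theorem K5plus3_connected : K5plus3.Connected := by
  rw [SimpleGraph.connected_iff_exists_forall_reachable]
  refine ⟨0, fun w => ?_⟩
  fin_cases w <;> first | rfl | exact SimpleGraph.Adj.reachable (by decide)

end Sharpness

end Graph

end TriangleCap

end PercRepro
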